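/-
Copyright (c) 2026. All rights reserved.
Released under Apache 2.0 license as described in the file LICENSE.
Authors: abc-iut cell — seat abc-iut-f-104 (F fact-proving wave, tranche 104: FACT-LIST row F-0182
`PanalocalizationExists` of `PanalocalTheaters.lean`), gen 3.
-/
import Literature.AnabelianGeometry.AbsoluteAnabelian.PanalocalTheatersGeneric
import Literature.AnabelianGeometry.AbsoluteAnabelian.NumberFieldValuationProSet
import Literature.AnabelianGeometry.AbsoluteAnabelian.MLFAbsoluteGaloisGroupInfinite
import HarnessLib

/-!
# [AbsTopIII] Def 5.1 (ii)/(iii)/(iv), Cor 5.2 (v): `Aut(Π)` respects `{⊚} ∪ V^non ∪ V^arc` for STRUCTURAL reasons —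
# the panalocalization `V⊚(Π)/Aut(Π)` exists whenever decomposition groups separate the three kinds of elements

S. Mochizuki, *Topics in absolute anabelian geometry III: global reconstruction algorithms*, J. Math. Sci. Univ.
Tokyo 22 (2015) 939–1156 [MochizukiAbsTopIII2015]; manuscript locators as in the trunk file `PanalocalTheaters.lean`
(abc-iut-L4-t3): Def 5.1 (ii) p. 115, (iii) pp. 115–116, (iv) p. 116, Cor 5.2 (v) p. 120.

PROOF-ONLY companion (no `def` / `structure` / `instance`) of `PanalocalTheaters.lean` for the FROZEN FACT-LIST row
**F-0182** `PanalocalizationExists` (`kernel_closedness = parametrised`; universal closure over the interface context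
REFUTED in `PanalocalTheatersCountermodels.lean`, instance form under the three PARTITION hypotheses `hgen`/`hnon`/`harc`
— "`Aut(Π)` acting through `R.mapProVal` respects `⊚`, `V^non`, `V^arc`" — in `PanalocalTheatersGeneric.lean`).
This file replaces those three ad-hoc hypotheses by STRUCTURAL ones on decomposition groups, from which they FOLLOW for
every context by the equivariance law `mapProVal_smul` alone:

* §1 (Def 5.1 (iii) "`Π_v` … the closed subgroup of elements that fix `v`"; (iii)(a) "`φ_Π` induces an open injection
  `Π_{v₁} ↪ Π_{v₂}`"): along an ISOMORPHISM `α : Π₁ ≅ Π₂` of `EA⊚`, `Π_{2,V(α)v} = α(Π_{1,v})` and, on the quotients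
  by `Δ`, `G_{2,V(α)v} = α_G(G_{1,v})` (`decomp_mapProVal_eq_map`, `galDecomp_mapProVal_eq_map`); hence "`Π_v = Π`" and
  "`G_v` is finite" are `Aut(Π)`-invariants of `v` (`decomp_mapProVal_eq_top_iff`, `galDecomp_mapProVal_finite_iff`).
* §2: if (S⊚) `⊚` is the ONLY element of `V⊚(Π)` fixed by all of `Π`, (S_arc) `G_v` is finite for archimedean `v` and
  (S_non) `G_v` is infinite for nonarchimedean `v`, then every automorphism of `Π` in `EA⊚` maps `⊚ ↦ ⊚`,
  `V^non → V^non`, `V^arc → V^arc` (`mapProVal_generic_of_decomp`, `mapProVal_mem_non_of_decomp`,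
  `mapProVal_mem_arc_of_decomp`).  In print all three hold: `V⊚(Π_X) = V⊚(F̄/F)` with `Π_X` acting through
  `Π_X ↠ G_F`, so `G_⊚ = G_F`, `G_v = Gal(F̄_v/F_v)` is infinite for `v` nonarchimedean and of order `≤ 2` for `v`
  archimedean, and no place of `F̄` is fixed by all of `G_F`.
* §3 (**F-0182**, Cor 5.2 (v) object part, STRUCTURAL INSTANCE FORM): (S⊚) ∧ (S_arc) ∧ (S_non) at every admissible `Π`
  ⟹ `PanalocalizationExists R` (`panalocalizationExists_of_decompositionStructure`, through
  `panalocalizationExists_of_mapProVal_mem`).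
* §4 — the structural hypotheses AT THE GENUINE PRO-SET `V⊚(F̄/F)` of a number field (abc-iut-L4-d2's
  `NumberField.valuationProSet F`, the `V⊚` of the number-field shadow context `GaloisTheatersNumberFieldShadow.lean`):
  (S_arc) HOLDS — the decomposition group of an archimedean local element (an infinite place of `F̄`) is Mathlib's
  stabiliser and has ORDER `1` OR `2` (`natCard_decomp_inr_inr`, from `NumberField.InfinitePlace.nat_card_stabilizer_eq_one_or_two`;
  `finite_decomp_of_mem_arc`); `Gal(F̄/F)` is INFINITE for a number field (`NumberField.infinite_absoluteGaloisGroup`: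
  `X^ℓ − 2` is irreducible over `F` for primes `ℓ > [F : ℚ]`), so the archimedean half of (S⊚) holds too
  (`decomp_inr_inr_ne_top`, `not_mem_arc_of_decomp_eq_top`).  NOT PROVED HERE (classical, recorded for the shadow-context
  programme): (S_non) "`D_v ⊆ G_F` is infinite" and the nonarchimedean half of (S⊚) "`D_v ≠ G_F`" for a finite place `v`
  of `F̄` — both immediate from `D_v ≅ Gal(F̄_v/F_v)` (Neukirch, *Algebraic Number Theory* II (9.6)/(8.6)), which is not in
  Mathlib; they stay hypotheses of §3.

HONEST LABEL: instance form for the cell's interface record `GlobalAnabelianContext` (no laws beyond `mapProVal_smul`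
are used); no genuine context `R` is assembled in the tree (étale `π₁`, Neukirch–Uchida: GAP G-L4d2g4-1), so nothing here
DISCHARGES F-0182 at the intended model; refereed pre-IUT anabelian geometry / classical algebraic number theory;
nothing here bears on, and no side is taken on, [IUTchIII] Cor. 3.12; typed ≠ proved.
-/

set_option autoImplicit false

namespace Literature.AnabelianGeometry.AbsoluteAnabelian

open CategoryTheory Topology

universe u

namespace GlobalAnabelianContext

variable {R : GlobalAnabelianContext.{u}}

/-! ### §1: transport of decomposition groups along isomorphisms of `EA⊚` -/

/-- For an isomorphism `α : Π₁ ≅ Π₂` of extensions, `α⁻¹ ∘ α = id` on `Π₁` (pointwise).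
[cite: MochizukiAbsTopIII2015, Def 5.1 (iii) p. 115] -/
theorem iso_inv_arith_hom_arith {E₁ E₂ : FundamentalExtension.{u}} (α : E₁ ≅ E₂) (g : E₁.arith) :
    α.inv.arith (α.hom.arith g) = g := by
  change (α.hom ≫ α.inv).arith g = g
  rw [α.hom_inv_id]
  rfl

/-- For an isomorphism `α : Π₁ ≅ Π₂` of extensions, `α ∘ α⁻¹ = id` on `Π₂` (pointwise).
[cite: MochizukiAbsTopIII2015, Def 5.1 (iii) p. 115] -/
theorem iso_hom_arith_inv_arith {E₁ E₂ : FundamentalExtension.{u}} (α : E₁ ≅ E₂) (h : E₂.arith) :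
    α.hom.arith (α.inv.arith h) = h := by
  change (α.inv ≫ α.hom).arith h = h
  rw [α.inv_hom_id]
  rfl

/-- For an isomorphism `α : Π₁ ≅ Π₂` of extensions, `α_G⁻¹ ∘ α_G = id` on `G₁` (pointwise).
[cite: MochizukiAbsTopIII2015, Def 5.1 (iii) p. 115] -/
theorem iso_inv_gal_hom_gal {E₁ E₂ : FundamentalExtension.{u}} (α : E₁ ≅ E₂) (g : E₁.gal) :
    α.inv.gal (α.hom.gal g) = g := by
  change (α.hom ≫ α.inv).gal g = g
  rw [α.hom_inv_id]
  rfl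

/-- **`Π_{2,V(α)v} = α(Π_{1,v})`**: along an isomorphism `α : Π₁ ≅ Π₂` of `EA⊚` the decomposition group (stabiliser,
Def 5.1 (iii)) of `V(α)(v)` is the image under `α` of that of `v` — the equivariance law `mapProVal_smul` and the
bijectivity of `α`. [cite: MochizukiAbsTopIII2015, Def 5.1 (iii) p. 116] -/
theorem decomp_mapProVal_eq_map {E₁ E₂ : FundamentalExtension.{u}} (α : E₁ ≅ E₂) (hα : IsEAHom α.hom)
    (v : (R.proVal E₁).carrier) :
    (R.proVal E₂).decomp (R.mapProVal α.hom hα v) =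
      ((R.proVal E₁).decomp v).map α.hom.arith.toMonoidHom := by
  ext h
  rw [Subgroup.mem_map]
  constructor
  · intro hh
    refine ⟨α.inv.arith h, ?_, iso_hom_arith_inv_arith α h⟩
    have hh' : α.hom.arith (α.inv.arith h) ∈ (R.proVal E₂).decomp (R.mapProVal α.hom hα v) := by
      rwa [iso_hom_arith_inv_arith]
    exact (mem_decomp_mapProVal_iff α.hom hα v _).mp hh'
  · rintro ⟨g, hg, rfl⟩
    exact (mem_decomp_mapProVal_iff α.hom hα v g).mpr hg

/-- **`G_{2,V(α)v} = α_G(G_{1,v})`**: along an isomorphism `α : Π₁ ≅ Π₂` of `EA⊚` the image `G_v := aug(Π_v) ⊆ G` of the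
decomposition group ("the quotient `Π_v ↠ G_v`", Def 5.6 (ii)) is transported by the `G`-component of `α`.
[cite: MochizukiAbsTopIII2015, Def 5.1 (iii) p. 116] -/
theorem galDecomp_mapProVal_eq_map {E₁ E₂ : FundamentalExtension.{u}} (α : E₁ ≅ E₂) (hα : IsEAHom α.hom)
    (v : (R.proVal E₁).carrier) :
    R.galDecomp E₂ (R.mapProVal α.hom hα v) = (R.galDecomp E₁ v).map α.hom.gal.toMonoidHom := by
  simp only [galDecomp]
  rw [decomp_mapProVal_eq_map, Subgroup.map_map, Subgroup.map_map]
  congr 1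
  ext g
  exact α.hom.comm g

/-- "`Π_v = Π`" is an `Aut(Π)`-invariant property of `v ∈ V⊚(Π)`: `Π_{2,V(α)v} = Π₂ ↔ Π_{1,v} = Π₁` for an isomorphism
`α : Π₁ ≅ Π₂` of `EA⊚`. [cite: MochizukiAbsTopIII2015, Def 5.1 (iii) p. 116] -/
theorem decomp_mapProVal_eq_top_iff {E₁ E₂ : FundamentalExtension.{u}} (α : E₁ ≅ E₂) (hα : IsEAHom α.hom)
    (v : (R.proVal E₁).carrier) :
    (R.proVal E₂).decomp (R.mapProVal α.hom hα v) = ⊤ ↔ (R.proVal E₁).decomp v = ⊤ := by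
  rw [decomp_mapProVal_eq_map]
  constructor
  · intro h
    rw [eq_top_iff]
    intro g _
    have hg : α.hom.arith g ∈ ((R.proVal E₁).decomp v).map α.hom.arith.toMonoidHom := by
      rw [h]
      exact Subgroup.mem_top _
    rw [Subgroup.mem_map] at hg
    obtain ⟨g', hg', hgg'⟩ := hg
    have : g' = g := hα.injective hgg'
    exact this ▸ hg'
  · intro h
    rw [h, eq_top_iff]
    intro y _
    rw [Subgroup.mem_map]
    exact ⟨α.inv.arith y, Subgroup.mem_top _, iso_hom_arith_inv_arith α y⟩

/-- "`G_v` is finite" is an `Aut(Π)`-invariant property of `v ∈ V⊚(Π)`: `G_{2,V(α)v}` is finite iff `G_{1,v}` is, for an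
isomorphism `α : Π₁ ≅ Π₂` of `EA⊚`. [cite: MochizukiAbsTopIII2015, Def 5.1 (iii) p. 116] -/
theorem galDecomp_mapProVal_finite_iff {E₁ E₂ : FundamentalExtension.{u}} (α : E₁ ≅ E₂) (hα : IsEAHom α.hom)
    (v : (R.proVal E₁).carrier) :
    (R.galDecomp E₂ (R.mapProVal α.hom hα v) : Set E₂.gal).Finite ↔ (R.galDecomp E₁ v : Set E₁.gal).Finite := by
  rw [galDecomp_mapProVal_eq_map, Subgroup.coe_map]
  refine Set.finite_image_iff (Set.injOn_of_injective ?_)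
  intro a b hab
  have h := congrArg α.inv.gal hab
  change α.inv.gal (α.hom.gal a) = α.inv.gal (α.hom.gal b) at h
  rwa [iso_inv_gal_hom_gal, iso_inv_gal_hom_gal] at h

/-- The decomposition group of `⊚` is all of `Π` ("the inverse system of `⊚_K`'s determines a unique global element",
fixed by `Π`). [cite: MochizukiAbsTopIII2015, Def 5.1 (i) p. 113] -/
theorem decomp_generic_eq_top (E : FundamentalExtension.{u}) :
    (R.proVal E).decomp (R.proVal E).generic = ⊤ := by
  rw [eq_top_iff]
  intro g _
  exact (R.proVal E).smul_generic g

/-! ### §2: structural separation of `⊚` / `V^non` / `V^arc` by decomposition groups ⟹ `Aut(Π)` respects the partition -/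

section Structure

variable {E : FundamentalExtension.{u}}
  (hfix : ∀ v : (R.proVal E).carrier, (R.proVal E).decomp v = ⊤ → v = (R.proVal E).generic)
  (harcFin : ∀ v : (R.proVal E).carrier, v ∈ (R.proVal E).arc → (R.galDecomp E v : Set E.gal).Finite)
  (hnonInf : ∀ v : (R.proVal E).carrier, v ∈ (R.proVal E).non → (R.galDecomp E v : Set E.gal).Infinite)

include hfix in
/-- (S⊚) "`⊚` is the only element fixed by all of `Π`" ⟹ every automorphism of `Π` in `EA⊚` fixes `⊚` (hypothesis `hgen`
of `panalocalizationExists_of_mapProVal_mem`, DERIVED). [cite: MochizukiAbsTopIII2015, Def 5.1 (ii) p. 115] -/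
theorem mapProVal_generic_of_decomp (α : E ≅ E) (hα : IsEAHom α.hom) :
    R.mapProVal α.hom hα (R.proVal E).generic = (R.proVal E).generic :=
  hfix _ ((decomp_mapProVal_eq_top_iff α hα _).mpr (decomp_generic_eq_top E))

include hfix harcFin hnonInf in
/-- (S⊚) ∧ (S_arc) "`G_v` finite for archimedean `v`" ∧ (S_non) "`G_v` infinite for nonarchimedean `v`" ⟹ every
automorphism of `Π` in `EA⊚` maps `V^non` into `V^non` (hypothesis `hnon`, DERIVED).
[cite: MochizukiAbsTopIII2015, Def 5.1 (ii) p. 115] -/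
theorem mapProVal_mem_non_of_decomp (α : E ≅ E) (hα : IsEAHom α.hom) (v : (R.proVal E).carrier)
    (hv : v ∈ (R.proVal E).non) : R.mapProVal α.hom hα v ∈ (R.proVal E).non := by
  rcases (R.proVal E).eq_generic_or_mem (R.mapProVal α.hom hα v) with h | h | h
  · have h1 : (R.proVal E).decomp (R.mapProVal α.hom hα v) = ⊤ := by
      rw [h]
      exact decomp_generic_eq_top E
    have h2 : v = (R.proVal E).generic := hfix v ((decomp_mapProVal_eq_top_iff α hα v).mp h1)
    exact absurd (h2 ▸ hv) (R.proVal E).generic_notMem_non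
  · exact h
  · exact absurd ((galDecomp_mapProVal_finite_iff α hα v).mp (harcFin _ h)) (hnonInf v hv)

include hfix harcFin hnonInf in
/-- (S⊚) ∧ (S_arc) ∧ (S_non) ⟹ every automorphism of `Π` in `EA⊚` maps `V^arc` into `V^arc` (hypothesis `harc`, DERIVED).
[cite: MochizukiAbsTopIII2015, Def 5.1 (ii) p. 115] -/
theorem mapProVal_mem_arc_of_decomp (α : E ≅ E) (hα : IsEAHom α.hom) (v : (R.proVal E).carrier)
    (hv : v ∈ (R.proVal E).arc) : R.mapProVal α.hom hα v ∈ (R.proVal E).arc := by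
  rcases (R.proVal E).eq_generic_or_mem (R.mapProVal α.hom hα v) with h | h | h
  · have h1 : (R.proVal E).decomp (R.mapProVal α.hom hα v) = ⊤ := by
      rw [h]
      exact decomp_generic_eq_top E
    have h2 : v = (R.proVal E).generic := hfix v ((decomp_mapProVal_eq_top_iff α hα v).mp h1)
    exact absurd (h2 ▸ hv) (R.proVal E).generic_notMem_arc
  · exact absurd ((galDecomp_mapProVal_finite_iff α hα v).mpr (harcFin v hv)) (hnonInf _ h)
  · exact h

end Structure

end GlobalAnabelianContext

/-! ### §3 (F-0182): the panalocalization exists under the structural hypotheses -/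

/-- **F-0182 (Def 5.1 (iv) / Cor 5.2 (v), object part), STRUCTURAL INSTANCE FORM — for EVERY context in which, at each
admissible `Π`, (S⊚) `⊚` is the only element of `V⊚(Π)` fixed by all of `Π`, (S_arc) `G_v = aug(Π_v)` is finite for
archimedean `v`, and (S_non) `G_v` is infinite for nonarchimedean `v`:** the panalocalization `V✠(Π)` of `V⊚(Π)` exists
(underlying set `V⊚(Π)/Aut(Π)`, `Π_v`/`X_v` of lifts, reference bijection `id` — `panalocalizationExists_of_mapProVal_mem`,
whose partition hypotheses are DERIVED here from the equivariance law `mapProVal_smul`).  In print (`V⊚(Π_X) = V⊚(F̄/F)`,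
`G_v = Gal(F̄_v/F_v)`, `|G_v| ≤ 2` at archimedean `v`) all three hold; they are not consequences of the interface
(`PanalocalTheatersCountermodels.lean`). [cite: MochizukiAbsTopIII2015, Cor 5.2 (v) p. 120] -/
theorem panalocalizationExists_of_decompositionStructure (R : GlobalAnabelianContext.{u})
    (hfix : ∀ E, R.IsAdmissible E → ∀ v : (R.proVal E).carrier,
      (R.proVal E).decomp v = ⊤ → v = (R.proVal E).generic)
    (harcFin : ∀ E, R.IsAdmissible E → ∀ v : (R.proVal E).carrier,
      v ∈ (R.proVal E).arc → (R.galDecomp E v : Set E.gal).Finite)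
    (hnonInf : ∀ E, R.IsAdmissible E → ∀ v : (R.proVal E).carrier,
      v ∈ (R.proVal E).non → (R.galDecomp E v : Set E.gal).Infinite) :
    PanalocalizationExists R :=
  panalocalizationExists_of_mapProVal_mem R
    (fun E hE α hα => GlobalAnabelianContext.mapProVal_generic_of_decomp (hfix E hE) α hα)
    (fun E hE α hα v hv =>
      GlobalAnabelianContext.mapProVal_mem_non_of_decomp (hfix E hE) (harcFin E hE) (hnonInf E hE) α hα v hv)
    (fun E hE α hα v hv =>
      GlobalAnabelianContext.mapProVal_mem_arc_of_decomp (hfix E hE) (harcFin E hE) (hnonInf E hE) α hα v hv)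

/-! ### §4: the structural hypotheses at the GENUINE pro-set `V⊚(F̄/F)` -/

section NumberFieldInstances

open Polynomial

/-- `2` is not an `ℓ`-th power in `ℚ` for `ℓ ≥ 2` (2-adic valuation: `v₂(b^ℓ) = ℓ·v₂(b) ≠ 1`).
[cite: MochizukiAbsTopIII2015, Def 5.1 (i) p. 113] -/
theorem _root_.Rat.forall_pow_ne_two {ℓ : ℕ} (hℓ : 2 ≤ ℓ) : ∀ b : ℚ, b ^ ℓ ≠ 2 := by
  intro b hb
  have hv := congrArg (padicValRat 2) hb
  have h2 : padicValRat 2 (2 : ℚ) = 1 := by exact_mod_cast padicValRat.self (p := 2) one_lt_two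
  rw [padicValRat.pow, h2] at hv
  have hdvd : (ℓ : ℤ) ∣ 1 := ⟨padicValRat 2 b, hv.symm⟩
  have : (ℓ : ℤ) = 1 := Int.eq_one_of_dvd_one (by positivity) hdvd
  omega

/-- **`X^ℓ − 2` is irreducible over a number field `F` for every prime `ℓ > [F : ℚ]`**: an `ℓ`-th root of `2` has degree
`ℓ` over `ℚ` (`X^ℓ − 2` is irreducible over `ℚ` by Kummer's criterion), so it cannot lie in `F`.
[cite: MochizukiAbsTopIII2015, Def 5.1 (i) p. 113] -/
theorem _root_.NumberField.irreducible_X_pow_sub_C_two (F : Type u) [Field F] [NumberField F] {ℓ : ℕ}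
    (hℓ : ℓ.Prime) (hd : Module.finrank ℚ F < ℓ) : Irreducible (X ^ ℓ - C (2 : F)) := by
  have hirrQ : Irreducible (X ^ ℓ - C (2 : ℚ)) :=
    (X_pow_sub_C_irreducible_iff_of_prime hℓ).2 (Rat.forall_pow_ne_two hℓ.two_le)
  refine (X_pow_sub_C_irreducible_iff_of_prime hℓ).2 fun b hb => ?_
  have hx : aeval b (X ^ ℓ - C (2 : ℚ)) = 0 := by
    simp only [map_sub, map_pow, aeval_X, map_ofNat, hb, sub_self]
  have hmin : X ^ ℓ - C (2 : ℚ) = minpoly ℚ b :=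
    minpoly.eq_of_irreducible_of_monic hirrQ hx (monic_X_pow_sub_C _ hℓ.ne_zero)
  have hle : (minpoly ℚ b).natDegree ≤ Module.finrank ℚ F := minpoly.natDegree_le b
  rw [← hmin, natDegree_X_pow_sub_C] at hle
  omega

/-- **The absolute Galois group `Gal(F̄/F)` of a number field is infinite** (irreducible separable polynomials `X^ℓ − 2`
of unbounded degree; `Field.infinite_absoluteGaloisGroup_of_irreducible`) — so no FINITE decomposition group is all of
`G_F`. [cite: MochizukiAbsTopIII2015, Def 5.1 (i) p. 113] -/
theorem _root_.NumberField.infinite_absoluteGaloisGroup (F : Type u) [Field F] [NumberField F] :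
    Infinite (Field.absoluteGaloisGroup F) := by
  refine Field.infinite_absoluteGaloisGroup_of_irreducible F fun n => ?_
  obtain ⟨ℓ, hnℓ, hℓ⟩ := Nat.exists_infinite_primes (n + Module.finrank ℚ F + 2)
  have hirr := NumberField.irreducible_X_pow_sub_C_two F hℓ (by omega)
  refine ⟨X ^ ℓ - C (2 : F), monic_X_pow_sub_C _ hℓ.ne_zero, hirr,
    PerfectField.separable_of_irreducible hirr, ?_⟩
  rw [natDegree_X_pow_sub_C]
  omega

end NumberFieldInstances

namespace NumberFieldValuationProSet

open Field NumberField

variable (F : Type) [Field F]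

/-- At `V⊚(F̄/F)`: the decomposition group of an archimedean local element `w` (an infinite place of `F̄`) has ORDER `1` OR
`2` — it is Mathlib's stabiliser of `w` in `Gal(F̄/F)`, `{1}` or `{1, c_w}` with `c_w` the complex conjugation of an
embedding in the class `w` (`NumberField.InfinitePlace.nat_card_stabilizer_eq_one_or_two`).  This is hypothesis (S_arc) of
`panalocalizationExists_of_decompositionStructure` at the genuine pro-set. [cite: MochizukiAbsTopIII2015, Def 5.1 (iii) p. 115] -/
theorem natCard_decomp_inr_inr (w : Arch F) :
    Nat.card ((NumberField.valuationProSet F).decomp (Sum.inr (Sum.inr w))) = 1 ∨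
      Nat.card ((NumberField.valuationProSet F).decomp (Sum.inr (Sum.inr w))) = 2 := by
  have h : (NumberField.valuationProSet F).decomp (Sum.inr (Sum.inr w)) =
      (letI := archAction F; MulAction.stabilizer (absoluteGaloisGroup F) w) := by
    ext σ
    rw [mem_decomp_inr_inr_iff]
    rfl
  rw [h]
  exact NumberField.InfinitePlace.nat_card_stabilizer_eq_one_or_two F w

/-- At `V⊚(F̄/F)`: the decomposition group of an archimedean local element is FINITE (order `≤ 2`).
[cite: MochizukiAbsTopIII2015, Def 5.1 (iii) p. 115] -/
theorem finite_decomp_inr_inr (w : Arch F) :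
    ((NumberField.valuationProSet F).decomp (Sum.inr (Sum.inr w)) : Set (absoluteGaloisGroup F)).Finite := by
  have hne : Nat.card ((NumberField.valuationProSet F).decomp (Sum.inr (Sum.inr w))) ≠ 0 := by
    rcases natCard_decomp_inr_inr F w with h | h <;> omega
  exact Set.finite_coe_iff.mp (Nat.finite_of_card_ne_zero hne)

/-- At `V⊚(F̄/F)`: (S_arc) — every archimedean local element has a finite decomposition group.
[cite: MochizukiAbsTopIII2015, Def 5.1 (iii) p. 115] -/
theorem finite_decomp_of_mem_arc (v : (NumberField.valuationProSet F).carrier)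
    (hv : v ∈ (NumberField.valuationProSet F).arc) :
    ((NumberField.valuationProSet F).decomp v : Set (absoluteGaloisGroup F)).Finite := by
  obtain ⟨w, rfl⟩ := hv
  exact finite_decomp_inr_inr F w

/-- At `V⊚(F̄/F)` for a NUMBER FIELD `F`: the decomposition group of an archimedean local element is a PROPER subgroup of
`G_F` (it is finite, `G_F` is infinite). [cite: MochizukiAbsTopIII2015, Def 5.1 (iii) p. 115] -/
theorem decomp_inr_inr_ne_top [NumberField F] (w : Arch F) :
    (NumberField.valuationProSet F).decomp (Sum.inr (Sum.inr w)) ≠ ⊤ := by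
  intro h
  have hfin := finite_decomp_inr_inr F w
  rw [h, Subgroup.coe_top] at hfin
  haveI := NumberField.infinite_absoluteGaloisGroup F
  exact Set.infinite_univ hfin

/-- At `V⊚(F̄/F)` for a number field `F`: the ARCHIMEDEAN HALF of (S⊚) — an element fixed by all of `G_F` is not
archimedean (the nonarchimedean half, "`D_v ≠ G_F` for a finite place `v` of `F̄`", is classical but not proved here).
[cite: MochizukiAbsTopIII2015, Def 5.1 (i) p. 113] -/
theorem not_mem_arc_of_decomp_eq_top [NumberField F] (v : (NumberField.valuationProSet F).carrier)
    (h : (NumberField.valuationProSet F).decomp v = ⊤) : v ∉ (NumberField.valuationProSet F).arc := by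
  rintro ⟨w, rfl⟩
  exact decomp_inr_inr_ne_top F w h

end NumberFieldValuationProSet

end Literature.AnabelianGeometry.AbsoluteAnabelian
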